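import Summits.QuantumFields.YangMills.Theorems.SwapVirialDeficitGnomonicTaylorHubLine
import Summits.QuantumFields.YangMills.Theorems.SwapVirialDeficitGnomonicDeficitSmooth
import Summits.QuantumFields.YangMills.Theorems.SwapVirialDeficitBlowUpGnomonicTranslatedDefs
import HarnessLib

/-!
# W4 jets and smoothness IN THE TRANSLATED CHART: the K7b ∕ K7d Taylor data and ✓`contDiff_gnoDeficit` transfer VERBATIM to ✓`trGnoDeficit u` for a unit `u`
# (sector-001 analytic inputs; LEAD sfw-p2 g98's memo7 plan of record for ⟨stmt-QuantumFields-24197⟩ `SwapVirialDeficit.SwapGluedStiffness`, §E(5))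

The translated chart ✓`trGnomonicPoint u a ε η` (✓`…TranslatedDefs`) differs from the master chart only in the leader `μ = 2`: `C₂ = Q(u·ŷ)` instead of `Q(ŷ)`, and
`su2Quat (Q(u·ŷ)) = u · su2Quat (Q ŷ)` for a unit `u` (left multiplication by a unit commutes with radial normalisation).  A constant unit factor does not change a
4-jet's sizes (✓`jet4_mul` with the size-`0` constant jet ✓`jet4_const`), so every per-leader jet of the K-series transfers, and with it the assembled Taylor data:
* §1 transfer (✓`ZeroModeSigma.radialUnit_mul_left`): `su2Quat_quatToSU2_unit_mul`, `trLeader_eq_of_ne_two` (`μ ≠ 2`: same leader), `su2Quat_trLeader_two` (`μ = 2`: `u·(master)`),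
  `trFollower_eq`, ★ `jet4_trLeaders_of_leaders` (any hub path, any coordinate path: master leader jets of size `B` ⟹ translated leader jets of size `B`);
* §2 ★★ `realJet4_trGnoDeficit_line_le` ∕ ★★★ `taylor_four_trGnoDeficit_line` — the twins of ✓`realJet4_gnoDeficit_line_le` ∕ ✓`taylor_four_gnoDeficit_line` (K7b):
  SAME constants `720L⁴S, 20400L⁴S², 2484000L⁴S³, 381240000L⁴S⁴`;
* §3 ★★ `realJet4_trGnoDeficit_hubLine_le` ∕ ★★★ `taylor_four_trGnoDeficit_hubLine` — the twins of the joint hub–letter line jets (K7d): SAME constants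
  `1008L⁴S, 39984L⁴S², 6816096L⁴S³, 1464571584L⁴S⁴`;
* §4 ★ `contDiff_trLeader`, ★★ `contDiff_trGnoDeficit` — `η ↦ F̂ᵘ_{z,a,ε}(η)` is `C^n` for `a ≠ 0` (twin of ✓`contDiff_gnoDeficit`);
* §5 (appended) ★ `contDiff_trLeader_hubShift`, ★★ `contDiff_trGnoDeficit_hubShift` — `(c, η) ↦ F̂ᵘ_{z, a − c·1, ε}(η)` is `C^n` jointly for `im a ≠ 0`
  (twin of w3 g66's ✓`contDiff_gnoDeficit_hubShift`), `contDiff_trGnoDeficit_hubShift_ray`.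
HONEST LABEL: calculus transfer at fixed `L`; nothing about ⟨24197⟩, ⟨24194⟩ or any rung is proved here; the Yang–Mills mass gap is NOT proved; no summit is proved
by a line.  Seat ym-line-fcl-p3 g47 (cell ym-idea-1, free hands ➎ assembler; item of record ⟨24085⟩ aside, untouched), `--supports stmt-QuantumFields-24197`.
THEOREMS ONLY (0 `def`, 0 `sorry`), standard axioms.  References: [cite: Luscher1983, §2]; [folklore].
-/

set_option autoImplicit false

noncomputable section

open Quaternion Set
open scoped Quaternion RealInnerProductSpace BigOperators
open Literature.MathematicalPhysics.QuantumLattice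
open Literature.MathematicalPhysics.QuantumFieldTheory hiding SU2
open Literature.Analysis.Calculus (radialUnit radialUnit_def norm_radialUnit)
open Summit.QuantumFields.YangMills.Theorems.FemtoTransferGap
open Summit.QuantumFields.YangMills.Theorems.FemtoTransferGap.TT
open Summit.QuantumFields.YangMills.Theorems.SwapTwistDeficit.ToronLog (axisPoint)
open Summit.QuantumFields.YangMills.Theorems.SwapVirialDeficit.ZeroModeSigma (su2Quat_quatToSU2_eq_radialUnit slaveP norm_axisUnit dil3 dil3_apply)
open Summit.QuantumFields.YangMills.Theorems.SwapVirialDeficit.BlowUp (leaderTuple dil3_one' dilateIm_one_apply qDeficit swapRingDeficit_eq_qDeficit)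
open Summit.QuantumFields.YangMills.Theorems.SwapVirialDeficit.BlowUpRing

namespace Summit.QuantumFields.YangMills.Theorems.SwapVirialDeficit.Gnomonic

variable {L : ℕ} [NeZero L]

/-! ## §1 Transfer: the translated leaders versus the master leaders -/

omit [NeZero L] in
/-- `su2Quat (Q(u·y)) = u · su2Quat (Q y)` for a unit `u` and `y ≠ 0`. [folklore] -/
theorem su2Quat_quatToSU2_unit_mul {u : ℍ} (hu : ‖u‖ = 1) {y : ℍ} (hy : y ≠ 0) : su2Quat (quatToSU2 (u * y)) = u * su2Quat (quatToSU2 y) := by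
  have hu0 : u ≠ 0 := fun h => by rw [h, norm_zero] at hu; exact zero_ne_one hu
  rw [su2Quat_quatToSU2_eq_radialUnit (mul_ne_zero hu0 hy), su2Quat_quatToSU2_eq_radialUnit hy, ZeroModeSigma.radialUnit_mul_left hu]

omit [NeZero L] in
/-- The leaders `μ ≠ 2` of the translated point are those of the master point. [folklore] -/
theorem trLeader_eq_of_ne_two (u a : ℍ) (ε : GnoSign L) (η : GnoCoord L) {μ : Fin 4} (hμ : μ ≠ 2) :
    (blowUpPoint (L := L) 1 (trGnomonicPoint u a ε η)).1 μ = (blowUpPoint (L := L) 1 (gnomonicPoint a ε η)).1 μ := by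
  rw [blowUpPoint_one_trGnomonicPoint, blowUpPoint_one_gnomonicPoint]
  show leaderTuple a _ μ = leaderTuple a _ μ
  match μ with
  | ⟨0, _⟩ => exact (BlowUp.leaderTuple_apply a _).1.trans (BlowUp.leaderTuple_apply a _).1.symm
  | ⟨1, _⟩ => exact (BlowUp.leaderTuple_apply a _).2.1.trans (BlowUp.leaderTuple_apply a _).2.1.symm
  | ⟨2, _⟩ => exact absurd rfl hμ
  | ⟨3, _⟩ => exact (BlowUp.leaderTuple_apply a _).2.2.2.trans (BlowUp.leaderTuple_apply a _).2.2.2.symm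

omit [NeZero L] in
/-- ★ The translated leader `μ = 2` as a quaternion: `su2Quat C₂ᵘ = u · su2Quat C₂` for a unit `u`. [folklore] -/
theorem su2Quat_trLeader_two {u : ℍ} (hu : ‖u‖ = 1) (a : ℍ) (ε : GnoSign L) (η : GnoCoord L) :
    su2Quat ((blowUpPoint (L := L) 1 (trGnomonicPoint u a ε η)).1 2) = u * su2Quat ((blowUpPoint (L := L) 1 (gnomonicPoint a ε η)).1 2) := by
  rw [blowUpPoint_one_trGnomonicPoint, blowUpPoint_one_gnomonicPoint]
  show su2Quat (leaderTuple a _ 2) = u * su2Quat (leaderTuple a _ 2)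
  rw [(BlowUp.leaderTuple_apply a _).2.2.1, (BlowUp.leaderTuple_apply a _).2.2.1]
  exact su2Quat_quatToSU2_unit_mul hu (gnoLetter_ne_zero _ _)

omit [NeZero L] in
/-- The followers of the translated point are those of the master point. [folklore] -/
theorem trFollower_eq (u a : ℍ) (ε : GnoSign L) (η : GnoCoord L) (i : Fol L) :
    (blowUpPoint (L := L) 1 (trGnomonicPoint u a ε η)).2 i = (blowUpPoint (L := L) 1 (gnomonicPoint a ε η)).2 i := by
  rw [blowUpPoint_one_trGnomonicPoint, blowUpPoint_one_gnomonicPoint]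

omit [NeZero L] in
/-- ★ **JET TRANSFER**: along any hub path `α` and coordinate path `γ`, per-leader 4-jets of size `B` of the master point give per-leader 4-jets of size `B` of the
translated point (leaders `μ ≠ 2` coincide; `μ = 2` is `u·(master)`, ✓`jet4_mul` with the size-`0` constant jet of `u`). [folklore] -/
theorem jet4_trLeaders_of_leaders {u : ℍ} (hu : ‖u‖ = 1) (α : ℝ → ℍ) (ε : GnoSign L) (γ : ℝ → GnoCoord L) {B : ℝ} (hB : 0 ≤ B)
    (h : ∀ μ : Fin 4, ∃ f₁ f₂ f₃ f₄ : ℝ → ℍ,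
      (∀ s, HasDerivAt (fun s : ℝ => su2Quat ((blowUpPoint (L := L) 1 (gnomonicPoint (α s) ε (γ s))).1 μ)) (f₁ s) s) ∧
      (∀ s, HasDerivAt f₁ (f₂ s) s) ∧ (∀ s, HasDerivAt f₂ (f₃ s) s) ∧ (∀ s, HasDerivAt f₃ (f₄ s) s) ∧
      ∀ s, ‖su2Quat ((blowUpPoint (L := L) 1 (gnomonicPoint (α s) ε (γ s))).1 μ)‖ ≤ 1 ∧ ‖f₁ s‖ ≤ B ∧ ‖f₂ s‖ ≤ B ^ 2 ∧
        ‖f₃ s‖ ≤ 3 * B ^ 3 ∧ ‖f₄ s‖ ≤ 9 * B ^ 4) (μ : Fin 4) :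
    ∃ f₁ f₂ f₃ f₄ : ℝ → ℍ,
      (∀ s, HasDerivAt (fun s : ℝ => su2Quat ((blowUpPoint (L := L) 1 (trGnomonicPoint u (α s) ε (γ s))).1 μ)) (f₁ s) s) ∧
      (∀ s, HasDerivAt f₁ (f₂ s) s) ∧ (∀ s, HasDerivAt f₂ (f₃ s) s) ∧ (∀ s, HasDerivAt f₃ (f₄ s) s) ∧
      ∀ s, ‖su2Quat ((blowUpPoint (L := L) 1 (trGnomonicPoint u (α s) ε (γ s))).1 μ)‖ ≤ 1 ∧ ‖f₁ s‖ ≤ B ∧ ‖f₂ s‖ ≤ B ^ 2 ∧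
        ‖f₃ s‖ ≤ 3 * B ^ 3 ∧ ‖f₄ s‖ ≤ 9 * B ^ 4 := by
  by_cases hμ : μ = 2
  · subst hμ
    have e : ∀ s : ℝ, u * su2Quat ((blowUpPoint (L := L) 1 (gnomonicPoint (α s) ε (γ s))).1 2) =
        su2Quat ((blowUpPoint (L := L) 1 (trGnomonicPoint u (α s) ε (γ s))).1 2) := fun s => (su2Quat_trLeader_two hu _ _ _).symm
    have hm := jet4_mul le_rfl hB (jet4_const u hu.le (le_refl (0 : ℝ))) (h 2)
    rw [zero_add] at hm
    simpa only [e] using hm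
  · have e : ∀ s : ℝ, su2Quat ((blowUpPoint (L := L) 1 (gnomonicPoint (α s) ε (γ s))).1 μ) =
        su2Quat ((blowUpPoint (L := L) 1 (trGnomonicPoint u (α s) ε (γ s))).1 μ) := fun s => by rw [trLeader_eq_of_ne_two u _ _ _ hμ]
    simpa only [e] using h μ

omit [NeZero L] in
/-- Follower jets transfer (the followers coincide). [folklore] -/
theorem jet4_trFollowers_of_followers (u : ℍ) (α : ℝ → ℍ) (ε : GnoSign L) (γ : ℝ → GnoCoord L) {B : ℝ}
    (h : ∀ i : Fol L, ∃ f₁ f₂ f₃ f₄ : ℝ → ℍ,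
      (∀ s, HasDerivAt (fun s : ℝ => su2Quat ((blowUpPoint (L := L) 1 (gnomonicPoint (α s) ε (γ s))).2 i)) (f₁ s) s) ∧
      (∀ s, HasDerivAt f₁ (f₂ s) s) ∧ (∀ s, HasDerivAt f₂ (f₃ s) s) ∧ (∀ s, HasDerivAt f₃ (f₄ s) s) ∧
      ∀ s, ‖su2Quat ((blowUpPoint (L := L) 1 (gnomonicPoint (α s) ε (γ s))).2 i)‖ ≤ 1 ∧ ‖f₁ s‖ ≤ B ∧ ‖f₂ s‖ ≤ B ^ 2 ∧
        ‖f₃ s‖ ≤ 3 * B ^ 3 ∧ ‖f₄ s‖ ≤ 9 * B ^ 4) (i : Fol L) :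
    ∃ f₁ f₂ f₃ f₄ : ℝ → ℍ,
      (∀ s, HasDerivAt (fun s : ℝ => su2Quat ((blowUpPoint (L := L) 1 (trGnomonicPoint u (α s) ε (γ s))).2 i)) (f₁ s) s) ∧
      (∀ s, HasDerivAt f₁ (f₂ s) s) ∧ (∀ s, HasDerivAt f₂ (f₃ s) s) ∧ (∀ s, HasDerivAt f₃ (f₄ s) s) ∧
      ∀ s, ‖su2Quat ((blowUpPoint (L := L) 1 (trGnomonicPoint u (α s) ε (γ s))).2 i)‖ ≤ 1 ∧ ‖f₁ s‖ ≤ B ∧ ‖f₂ s‖ ≤ B ^ 2 ∧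
        ‖f₃ s‖ ≤ 3 * B ^ 3 ∧ ‖f₄ s‖ ≤ 9 * B ^ 4 := by
  have e : ∀ s : ℝ, su2Quat ((blowUpPoint (L := L) 1 (gnomonicPoint (α s) ε (γ s))).2 i) =
      su2Quat ((blowUpPoint (L := L) 1 (trGnomonicPoint u (α s) ε (γ s))).2 i) := fun s => by rw [trFollower_eq]
  simpa only [e] using h i

/-! ## §2 Taylor data along every line of the translated chart (K7b twin) -/

set_option maxHeartbeats 400000 in
/-- ★★ **FOUR DERIVATIVE WITNESSES OF `s ↦ F̂ᵘ(η + s·ξ)`** (`a ≠ 0`, unit `u`, letter sizes of `ξ` `≤ S`), bounds `720L⁴S, 20400L⁴S², 2484000L⁴S³, 381240000L⁴S⁴`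
— the verbatim twin of ✓`realJet4_gnoDeficit_line_le`. [cite: Luscher1983, §2] -/
theorem realJet4_trGnoDeficit_line_le {u : ℍ} (hu : ‖u‖ = 1) (z : Fin 3 → Bool) (χ : Site 3 L → SU2) {a : ℍ} (ha : a ≠ 0) (ε : GnoSign L)
    (η ξ : GnoCoord L) {S : ℝ} (hS : 0 ≤ S) (hx : Real.sqrt (∑ k, ξ.1.1 k ^ 2) ≤ S) (hy : Real.sqrt (∑ k, ξ.1.2 k ^ 2) ≤ S)
    (hz : Real.sqrt (∑ k, ξ.2.1 k ^ 2) ≤ S) (hf : ∀ i, Real.sqrt (∑ k, ξ.2.2 i k ^ 2) ≤ S) :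
    ∃ d₁ d₂ d₃ d₄ : ℝ → ℝ, (∀ s, HasDerivAt (fun s : ℝ => trGnoDeficit u z χ a ε (η + s • ξ)) (d₁ s) s) ∧
      (∀ s, HasDerivAt d₁ (d₂ s) s) ∧ (∀ s, HasDerivAt d₂ (d₃ s) s) ∧ (∀ s, HasDerivAt d₃ (d₄ s) s) ∧
      ∀ s, |d₁ s| ≤ 720 * (L : ℝ) ^ 4 * S ∧ |d₂ s| ≤ 20400 * (L : ℝ) ^ 4 * S ^ 2 ∧ |d₃ s| ≤ 2484000 * (L : ℝ) ^ 4 * S ^ 3 ∧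
        |d₄ s| ≤ 381240000 * (L : ℝ) ^ 4 * S ^ 4 := by
  -- the master letters: leaders `≤ 3S`, followers `≤ S`
  have hC₀ : ∀ μ : Fin 4, ∃ f₁ f₂ f₃ f₄ : ℝ → ℍ,
      (∀ s, HasDerivAt (fun s : ℝ => su2Quat ((blowUpPoint (L := L) 1 (gnomonicPoint ((fun _ : ℝ => a) s) ε ((fun s : ℝ => η + s • ξ) s))).1 μ)) (f₁ s) s) ∧
      (∀ s, HasDerivAt f₁ (f₂ s) s) ∧ (∀ s, HasDerivAt f₂ (f₃ s) s) ∧ (∀ s, HasDerivAt f₃ (f₄ s) s) ∧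
      ∀ s, ‖su2Quat ((blowUpPoint (L := L) 1 (gnomonicPoint ((fun _ : ℝ => a) s) ε ((fun s : ℝ => η + s • ξ) s))).1 μ)‖ ≤ 1 ∧ ‖f₁ s‖ ≤ 3 * S ∧
        ‖f₂ s‖ ≤ (3 * S) ^ 2 ∧ ‖f₃ s‖ ≤ 3 * (3 * S) ^ 3 ∧ ‖f₄ s‖ ≤ 9 * (3 * S) ^ 4 :=
    fun μ => jet4_mono (by positivity) (by linarith) (jet4_leader_line ha ε η ξ μ)
  have hU₀ : ∀ i : Fol L, ∃ f₁ f₂ f₃ f₄ : ℝ → ℍ,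
      (∀ s, HasDerivAt (fun s : ℝ => su2Quat ((blowUpPoint (L := L) 1 (gnomonicPoint ((fun _ : ℝ => a) s) ε ((fun s : ℝ => η + s • ξ) s))).2 i)) (f₁ s) s) ∧
      (∀ s, HasDerivAt f₁ (f₂ s) s) ∧ (∀ s, HasDerivAt f₂ (f₃ s) s) ∧ (∀ s, HasDerivAt f₃ (f₄ s) s) ∧
      ∀ s, ‖su2Quat ((blowUpPoint (L := L) 1 (gnomonicPoint ((fun _ : ℝ => a) s) ε ((fun s : ℝ => η + s • ξ) s))).2 i)‖ ≤ 1 ∧ ‖f₁ s‖ ≤ S ∧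
        ‖f₂ s‖ ≤ S ^ 2 ∧ ‖f₃ s‖ ≤ 3 * S ^ 3 ∧ ‖f₄ s‖ ≤ 9 * S ^ 4 :=
    fun i => jet4_mono (Real.sqrt_nonneg _) (hf i) (jet4_follower_line a ε η ξ i)
  have hC := jet4_trLeaders_of_leaders (L := L) hu (fun _ => a) ε (fun s => η + s • ξ) (by positivity : (0 : ℝ) ≤ 3 * S) hC₀
  have hU := jet4_trFollowers_of_followers (L := L) u (fun _ => a) ε (fun s => η + s • ξ) hU₀
  -- the words and the deficit
  obtain ⟨hl, hs⟩ := jet4_fixHistory (C := fun s => (blowUpPoint (L := L) 1 (trGnomonicPoint u a ε (η + s • ξ))).1)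
    (U := fun s => (blowUpPoint (L := L) 1 (trGnomonicPoint u a ε (η + s • ξ))).2) χ (by positivity : (0 : ℝ) ≤ 3 * S) hS hC hU
  have e5 : 3 * S + S + S = 5 * S := by ring
  rw [e5] at hl hs
  have h := realJet4_qDeficit_le (L := L) z (M := 5 * S) (by positivity)
    (Q := fun s => ((fun (i : Fin (2 * L - 1 + 1)) (e : Edge 3 L) =>
        su2Quat ((fixHistory (ringConfig χ (blowUpPoint (L := L) 1 (trGnomonicPoint u a ε (η + s • ξ))))).1 i e)),
      fun x : Site 3 L => su2Quat ((fixHistory (ringConfig χ (blowUpPoint (L := L) 1 (trGnomonicPoint u a ε (η + s • ξ))))).2 x)))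
    (fun i e => hl i e) (fun x => hs x)
  have e : (fun s : ℝ => trGnoDeficit u z χ a ε (η + s • ξ)) = fun s => qDeficit z
      ((fun (i : Fin (2 * L - 1 + 1)) (e : Edge 3 L) => su2Quat ((fixHistory (ringConfig χ (blowUpPoint (L := L) 1 (trGnomonicPoint u a ε (η + s • ξ))))).1 i e)),
        fun x : Site 3 L => su2Quat ((fixHistory (ringConfig χ (blowUpPoint (L := L) 1 (trGnomonicPoint u a ε (η + s • ξ))))).2 x)) :=
    funext fun s => swapRingDeficit_eq_qDeficit z _
  rw [e]
  refine realJet4_mono ?_ ?_ ?_ ?_ h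
  · nlinarith [pow_nonneg (Nat.cast_nonneg L : (0 : ℝ) ≤ L) 4]
  · nlinarith [pow_nonneg (Nat.cast_nonneg L : (0 : ℝ) ≤ L) 4, sq_nonneg S]
  · nlinarith [pow_nonneg (Nat.cast_nonneg L : (0 : ℝ) ≤ L) 4, pow_nonneg hS 3]
  · nlinarith [pow_nonneg (Nat.cast_nonneg L : (0 : ℝ) ≤ L) 4, pow_nonneg hS 4]

/-- ★★★ **THE TRANSLATED DEFICIT IS `C⁴`-BOUNDED ON THE WHOLE CHART** (Taylor data along every line; twin of ✓`taylor_four_gnoDeficit_line`): for `a ≠ 0`, a unit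
`u`, letter sizes of `ξ` `≤ S`, and `ψ s = trGnoDeficit u z χ a ε (η + s • ξ)`: `|ψ′| ≤ 720L⁴S`, `|ψ″| ≤ 20400L⁴S²`, `|ψ‴| ≤ 2484000L⁴S³`, `|ψ⁗| ≤ 381240000L⁴S⁴`
EVERYWHERE, and the two Taylor remainders at `s = 0`. [cite: Luscher1983, §2] -/
theorem taylor_four_trGnoDeficit_line {u : ℍ} (hu : ‖u‖ = 1) (z : Fin 3 → Bool) (χ : Site 3 L → SU2) {a : ℍ} (ha : a ≠ 0) (ε : GnoSign L)
    (η ξ : GnoCoord L) {S : ℝ} (hS : 0 ≤ S) (hx : Real.sqrt (∑ k, ξ.1.1 k ^ 2) ≤ S) (hy : Real.sqrt (∑ k, ξ.1.2 k ^ 2) ≤ S)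
    (hz : Real.sqrt (∑ k, ξ.2.1 k ^ 2) ≤ S) (hf : ∀ i, Real.sqrt (∑ k, ξ.2.2 i k ^ 2) ≤ S) :
    (∀ s, |deriv (fun s : ℝ => trGnoDeficit u z χ a ε (η + s • ξ)) s| ≤ 720 * (L : ℝ) ^ 4 * S ∧
        |iteratedDeriv 2 (fun s : ℝ => trGnoDeficit u z χ a ε (η + s • ξ)) s| ≤ 20400 * (L : ℝ) ^ 4 * S ^ 2 ∧
        |iteratedDeriv 3 (fun s : ℝ => trGnoDeficit u z χ a ε (η + s • ξ)) s| ≤ 2484000 * (L : ℝ) ^ 4 * S ^ 3 ∧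
        |iteratedDeriv 4 (fun s : ℝ => trGnoDeficit u z χ a ε (η + s • ξ)) s| ≤ 381240000 * (L : ℝ) ^ 4 * S ^ 4) ∧
      |trGnoDeficit u z χ a ε (η + ξ) - trGnoDeficit u z χ a ε η - deriv (fun s : ℝ => trGnoDeficit u z χ a ε (η + s • ξ)) 0 -
          iteratedDeriv 2 (fun s : ℝ => trGnoDeficit u z χ a ε (η + s • ξ)) 0 / 2| ≤ 2484000 * (L : ℝ) ^ 4 * S ^ 3 / 2 ∧
      |trGnoDeficit u z χ a ε (η + ξ) - trGnoDeficit u z χ a ε η - deriv (fun s : ℝ => trGnoDeficit u z χ a ε (η + s • ξ)) 0 -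
          iteratedDeriv 2 (fun s : ℝ => trGnoDeficit u z χ a ε (η + s • ξ)) 0 / 2 -
          iteratedDeriv 3 (fun s : ℝ => trGnoDeficit u z χ a ε (η + s • ξ)) 0 / 6| ≤ 381240000 * (L : ℝ) ^ 4 * S ^ 4 / 6 := by
  obtain ⟨d₁, d₂, d₃, d₄, h₁, h₂, h₃, h₄, hb⟩ := realJet4_trGnoDeficit_line_le hu z χ ha ε η ξ hS hx hy hz hf
  obtain ⟨e1, e2, e3, e4⟩ := iteratedDeriv_eq_of_hasDerivAt_chain h₁ h₂ h₃ h₄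
  have e1' : trGnoDeficit u z χ a ε (η + ξ) = (fun s : ℝ => trGnoDeficit u z χ a ε (η + s • ξ)) 1 := by simp only [one_smul]
  have e0' : trGnoDeficit u z χ a ε η = (fun s : ℝ => trGnoDeficit u z χ a ε (η + s • ξ)) 0 := by simp only [zero_smul, add_zero]
  refine ⟨fun s => ?_, ?_, ?_⟩
  · rw [e1, e2, e3, e4]; exact hb s
  · rw [e1, e2, e1', e0']
    exact abs_taylor_three_remainder_le h₁ h₂ h₃ (fun s _ => (hb s).2.2.1)
  · rw [e1, e2, e3, e1', e0']
    exact abs_taylor_four_remainder_le h₁ h₂ h₃ h₄ (fun s _ => (hb s).2.2.2)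

/-! ## §3 Taylor data along joint hub–letter lines of the translated chart (K7d twin) -/

set_option maxHeartbeats 400000 in
/-- ★★ **FOUR DERIVATIVE WITNESSES OF `s ↦ F̂ᵘ_{a − (sδ₁)·1, ε}(η + s·ξ)`** (`im a ≠ 0`, unit `u`, `|δ₁| ≤ S·‖im a‖`, letter sizes `≤ S`), bounds
`1008L⁴S, 39984L⁴S², 6816096L⁴S³, 1464571584L⁴S⁴` — the verbatim twin of ✓`realJet4_gnoDeficit_hubLine_le`. [cite: Luscher1983, §2] -/
theorem realJet4_trGnoDeficit_hubLine_le {u : ℍ} (hu : ‖u‖ = 1) (z : Fin 3 → Bool) (χ : Site 3 L → SU2) {a : ℍ} (ha : a.im ≠ 0) (δ₁ : ℝ)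
    (ε : GnoSign L) (η ξ : GnoCoord L) {S : ℝ} (hS : 0 ≤ S) (hδ : |δ₁| ≤ S * ‖a.im‖) (hx : Real.sqrt (∑ k, ξ.1.1 k ^ 2) ≤ S)
    (hy : Real.sqrt (∑ k, ξ.1.2 k ^ 2) ≤ S) (hz : Real.sqrt (∑ k, ξ.2.1 k ^ 2) ≤ S) (hf : ∀ i, Real.sqrt (∑ k, ξ.2.2 i k ^ 2) ≤ S) :
    ∃ d₁ d₂ d₃ d₄ : ℝ → ℝ, (∀ s, HasDerivAt (fun s : ℝ => trGnoDeficit u z χ (a - (s * δ₁) • (1 : ℍ)) ε (η + s • ξ)) (d₁ s) s) ∧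
      (∀ s, HasDerivAt d₁ (d₂ s) s) ∧ (∀ s, HasDerivAt d₂ (d₃ s) s) ∧ (∀ s, HasDerivAt d₃ (d₄ s) s) ∧
      ∀ s, |d₁ s| ≤ 1008 * (L : ℝ) ^ 4 * S ∧ |d₂ s| ≤ 39984 * (L : ℝ) ^ 4 * S ^ 2 ∧ |d₃ s| ≤ 6816096 * (L : ℝ) ^ 4 * S ^ 3 ∧
        |d₄ s| ≤ 1464571584 * (L : ℝ) ^ 4 * S ^ 4 := by
  have hn : 0 < ‖a.im‖ := norm_pos_iff.2 ha
  have hH : |δ₁| / ‖a.im‖ ≤ S := by rw [div_le_iff₀ hn]; exact hδ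
  -- the master letters: leaders `≤ 5S`, followers `≤ S`
  have hC₀ : ∀ μ : Fin 4, ∃ f₁ f₂ f₃ f₄ : ℝ → ℍ,
      (∀ s, HasDerivAt (fun s : ℝ => su2Quat ((blowUpPoint (L := L) 1
        (gnomonicPoint ((fun s : ℝ => a - (s * δ₁) • (1 : ℍ)) s) ε ((fun s : ℝ => η + s • ξ) s))).1 μ)) (f₁ s) s) ∧
      (∀ s, HasDerivAt f₁ (f₂ s) s) ∧ (∀ s, HasDerivAt f₂ (f₃ s) s) ∧ (∀ s, HasDerivAt f₃ (f₄ s) s) ∧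
      ∀ s, ‖su2Quat ((blowUpPoint (L := L) 1 (gnomonicPoint ((fun s : ℝ => a - (s * δ₁) • (1 : ℍ)) s) ε ((fun s : ℝ => η + s • ξ) s))).1 μ)‖ ≤ 1 ∧
        ‖f₁ s‖ ≤ 5 * S ∧ ‖f₂ s‖ ≤ (5 * S) ^ 2 ∧ ‖f₃ s‖ ≤ 3 * (5 * S) ^ 3 ∧ ‖f₄ s‖ ≤ 9 * (5 * S) ^ 4 :=
    fun μ => jet4_mono (by positivity) (by linarith) (jet4_leader_hubLine ha δ₁ ε η ξ μ)
  have hU₀ : ∀ i : Fol L, ∃ f₁ f₂ f₃ f₄ : ℝ → ℍ,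
      (∀ s, HasDerivAt (fun s : ℝ => su2Quat ((blowUpPoint (L := L) 1
        (gnomonicPoint ((fun s : ℝ => a - (s * δ₁) • (1 : ℍ)) s) ε ((fun s : ℝ => η + s • ξ) s))).2 i)) (f₁ s) s) ∧
      (∀ s, HasDerivAt f₁ (f₂ s) s) ∧ (∀ s, HasDerivAt f₂ (f₃ s) s) ∧ (∀ s, HasDerivAt f₃ (f₄ s) s) ∧
      ∀ s, ‖su2Quat ((blowUpPoint (L := L) 1 (gnomonicPoint ((fun s : ℝ => a - (s * δ₁) • (1 : ℍ)) s) ε ((fun s : ℝ => η + s • ξ) s))).2 i)‖ ≤ 1 ∧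
        ‖f₁ s‖ ≤ S ∧ ‖f₂ s‖ ≤ S ^ 2 ∧ ‖f₃ s‖ ≤ 3 * S ^ 3 ∧ ‖f₄ s‖ ≤ 9 * S ^ 4 :=
    fun i => jet4_mono (Real.sqrt_nonneg _) (hf i) (jet4_follower_hubLine a δ₁ ε η ξ i)
  have hC := jet4_trLeaders_of_leaders (L := L) hu (fun s : ℝ => a - (s * δ₁) • (1 : ℍ)) ε (fun s => η + s • ξ) (by positivity : (0 : ℝ) ≤ 5 * S) hC₀
  have hU := jet4_trFollowers_of_followers (L := L) u (fun s : ℝ => a - (s * δ₁) • (1 : ℍ)) ε (fun s => η + s • ξ) hU₀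
  -- the words and the deficit
  obtain ⟨hl, hs⟩ := jet4_fixHistory (C := fun s => (blowUpPoint (L := L) 1 (trGnomonicPoint u (a - (s * δ₁) • (1 : ℍ)) ε (η + s • ξ))).1)
    (U := fun s => (blowUpPoint (L := L) 1 (trGnomonicPoint u (a - (s * δ₁) • (1 : ℍ)) ε (η + s • ξ))).2) χ (by positivity : (0 : ℝ) ≤ 5 * S) hS hC hU
  have e7 : 5 * S + S + S = 7 * S := by ring
  rw [e7] at hl hs
  have h := realJet4_qDeficit_le (L := L) z (M := 7 * S) (by positivity)
    (Q := fun s => ((fun (i : Fin (2 * L - 1 + 1)) (e : Edge 3 L) =>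
        su2Quat ((fixHistory (ringConfig χ (blowUpPoint (L := L) 1 (trGnomonicPoint u (a - (s * δ₁) • (1 : ℍ)) ε (η + s • ξ))))).1 i e)),
      fun x : Site 3 L => su2Quat ((fixHistory (ringConfig χ (blowUpPoint (L := L) 1 (trGnomonicPoint u (a - (s * δ₁) • (1 : ℍ)) ε (η + s • ξ))))).2 x)))
    (fun i e => hl i e) (fun x => hs x)
  have e : (fun s : ℝ => trGnoDeficit u z χ (a - (s * δ₁) • (1 : ℍ)) ε (η + s • ξ)) = fun s => qDeficit z
      ((fun (i : Fin (2 * L - 1 + 1)) (e : Edge 3 L) =>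
          su2Quat ((fixHistory (ringConfig χ (blowUpPoint (L := L) 1 (trGnomonicPoint u (a - (s * δ₁) • (1 : ℍ)) ε (η + s • ξ))))).1 i e)),
        fun x : Site 3 L => su2Quat ((fixHistory (ringConfig χ (blowUpPoint (L := L) 1 (trGnomonicPoint u (a - (s * δ₁) • (1 : ℍ)) ε (η + s • ξ))))).2 x)) :=
    funext fun s => swapRingDeficit_eq_qDeficit z _
  rw [e]
  refine realJet4_mono ?_ ?_ ?_ ?_ h
  · nlinarith [pow_nonneg (Nat.cast_nonneg L : (0 : ℝ) ≤ L) 4]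
  · nlinarith [pow_nonneg (Nat.cast_nonneg L : (0 : ℝ) ≤ L) 4, sq_nonneg S]
  · nlinarith [pow_nonneg (Nat.cast_nonneg L : (0 : ℝ) ≤ L) 4, pow_nonneg hS 3]
  · nlinarith [pow_nonneg (Nat.cast_nonneg L : (0 : ℝ) ≤ L) 4, pow_nonneg hS 4]

/-- ★★★ **THE TRANSLATED DEFICIT IS `C⁴`-BOUNDED ALONG JOINT HUB–LETTER LINES** (twin of ✓`taylor_four_gnoDeficit_hubLine`): for `im a ≠ 0`, a unit `u`,
`|δ₁| ≤ S·‖im a‖`, letter sizes `≤ S`, and `ψ s = trGnoDeficit u z χ (a − (sδ₁)·1) ε (η + s • ξ)`: `|ψ′| ≤ 1008L⁴S`, `|ψ″| ≤ 39984L⁴S²`, `|ψ‴| ≤ 6816096L⁴S³`,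
`|ψ⁗| ≤ 1464571584L⁴S⁴` EVERYWHERE, and the two Taylor remainders at `s = 0`. [cite: Luscher1983, §2] -/
theorem taylor_four_trGnoDeficit_hubLine {u : ℍ} (hu : ‖u‖ = 1) (z : Fin 3 → Bool) (χ : Site 3 L → SU2) {a : ℍ} (ha : a.im ≠ 0) (δ₁ : ℝ)
    (ε : GnoSign L) (η ξ : GnoCoord L) {S : ℝ} (hS : 0 ≤ S) (hδ : |δ₁| ≤ S * ‖a.im‖) (hx : Real.sqrt (∑ k, ξ.1.1 k ^ 2) ≤ S)
    (hy : Real.sqrt (∑ k, ξ.1.2 k ^ 2) ≤ S) (hz : Real.sqrt (∑ k, ξ.2.1 k ^ 2) ≤ S) (hf : ∀ i, Real.sqrt (∑ k, ξ.2.2 i k ^ 2) ≤ S) :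
    (∀ s, |deriv (fun s : ℝ => trGnoDeficit u z χ (a - (s * δ₁) • (1 : ℍ)) ε (η + s • ξ)) s| ≤ 1008 * (L : ℝ) ^ 4 * S ∧
        |iteratedDeriv 2 (fun s : ℝ => trGnoDeficit u z χ (a - (s * δ₁) • (1 : ℍ)) ε (η + s • ξ)) s| ≤ 39984 * (L : ℝ) ^ 4 * S ^ 2 ∧
        |iteratedDeriv 3 (fun s : ℝ => trGnoDeficit u z χ (a - (s * δ₁) • (1 : ℍ)) ε (η + s • ξ)) s| ≤ 6816096 * (L : ℝ) ^ 4 * S ^ 3 ∧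
        |iteratedDeriv 4 (fun s : ℝ => trGnoDeficit u z χ (a - (s * δ₁) • (1 : ℍ)) ε (η + s • ξ)) s| ≤ 1464571584 * (L : ℝ) ^ 4 * S ^ 4) ∧
      |trGnoDeficit u z χ (a - δ₁ • (1 : ℍ)) ε (η + ξ) - trGnoDeficit u z χ a ε η -
          deriv (fun s : ℝ => trGnoDeficit u z χ (a - (s * δ₁) • (1 : ℍ)) ε (η + s • ξ)) 0 -
          iteratedDeriv 2 (fun s : ℝ => trGnoDeficit u z χ (a - (s * δ₁) • (1 : ℍ)) ε (η + s • ξ)) 0 / 2| ≤ 6816096 * (L : ℝ) ^ 4 * S ^ 3 / 2 ∧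
      |trGnoDeficit u z χ (a - δ₁ • (1 : ℍ)) ε (η + ξ) - trGnoDeficit u z χ a ε η -
          deriv (fun s : ℝ => trGnoDeficit u z χ (a - (s * δ₁) • (1 : ℍ)) ε (η + s • ξ)) 0 -
          iteratedDeriv 2 (fun s : ℝ => trGnoDeficit u z χ (a - (s * δ₁) • (1 : ℍ)) ε (η + s • ξ)) 0 / 2 -
          iteratedDeriv 3 (fun s : ℝ => trGnoDeficit u z χ (a - (s * δ₁) • (1 : ℍ)) ε (η + s • ξ)) 0 / 6| ≤ 1464571584 * (L : ℝ) ^ 4 * S ^ 4 / 6 := by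
  obtain ⟨d₁, d₂, d₃, d₄, h₁, h₂, h₃, h₄, hb⟩ := realJet4_trGnoDeficit_hubLine_le hu z χ ha δ₁ ε η ξ hS hδ hx hy hz hf
  obtain ⟨e1, e2, e3, e4⟩ := iteratedDeriv_eq_of_hasDerivAt_chain h₁ h₂ h₃ h₄
  have e1' : trGnoDeficit u z χ (a - δ₁ • (1 : ℍ)) ε (η + ξ) = (fun s : ℝ => trGnoDeficit u z χ (a - (s * δ₁) • (1 : ℍ)) ε (η + s • ξ)) 1 := by
    simp only [one_smul, one_mul]
  have e0' : trGnoDeficit u z χ a ε η = (fun s : ℝ => trGnoDeficit u z χ (a - (s * δ₁) • (1 : ℍ)) ε (η + s • ξ)) 0 := by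
    simp only [zero_smul, add_zero, zero_mul, sub_zero]
  refine ⟨fun s => ?_, ?_, ?_⟩
  · rw [e1, e2, e3, e4]; exact hb s
  · rw [e1, e2, e1', e0']
    exact abs_taylor_three_remainder_le h₁ h₂ h₃ (fun s _ => (hb s).2.2.1)
  · rw [e1, e2, e3, e1', e0']
    exact abs_taylor_four_remainder_le h₁ h₂ h₃ h₄ (fun s _ => (hb s).2.2.2)

/-! ## §4 Smoothness in the coordinates (twin of ✓`contDiff_gnoDeficit`) -/

/-- ★ **Every leader of `blowUpPoint 1 (trGnomonicPoint u a ε η)` is `C^n` in `η`** (`a ≠ 0`, unit `u`). [folklore] -/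
theorem contDiff_trLeader {n : ℕ∞} {u : ℍ} (hu : ‖u‖ = 1) {a : ℍ} (ha : a ≠ 0) (ε : GnoSign L) (μ : Fin 4) :
    ContDiff ℝ n fun η : GnoCoord L => su2Quat ((blowUpPoint (L := L) 1 (trGnomonicPoint u a ε η)).1 μ) := by
  by_cases hμ : μ = 2
  · subst hμ
    have e : (fun η : GnoCoord L => su2Quat ((blowUpPoint (L := L) 1 (trGnomonicPoint u a ε η)).1 2)) =
        fun η => u * su2Quat ((blowUpPoint (L := L) 1 (gnomonicPoint a ε η)).1 2) := funext fun η => su2Quat_trLeader_two hu a ε η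
    rw [e]
    exact contDiff_const.mul (contDiff_leader_gnomonic ha ε 2)
  · have e : (fun η : GnoCoord L => su2Quat ((blowUpPoint (L := L) 1 (trGnomonicPoint u a ε η)).1 μ)) =
        fun η => su2Quat ((blowUpPoint (L := L) 1 (gnomonicPoint a ε η)).1 μ) := funext fun η => by rw [trLeader_eq_of_ne_two u a ε η hμ]
    rw [e]
    exact contDiff_leader_gnomonic ha ε μ

/-- Every follower of `blowUpPoint 1 (trGnomonicPoint u a ε η)` is `C^n` in `η`. [folklore] -/
theorem contDiff_trFollower {n : ℕ∞} (u a : ℍ) (ε : GnoSign L) (i : Fol L) :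
    ContDiff ℝ n fun η : GnoCoord L => su2Quat ((blowUpPoint (L := L) 1 (trGnomonicPoint u a ε η)).2 i) := by
  have e : (fun η : GnoCoord L => su2Quat ((blowUpPoint (L := L) 1 (trGnomonicPoint u a ε η)).2 i)) =
      fun η => su2Quat ((blowUpPoint (L := L) 1 (gnomonicPoint a ε η)).2 i) := funext fun η => by rw [trFollower_eq]
  rw [e]
  exact contDiff_follower_gnomonic a ε i

/-- ★★ **`η ↦ F̂ᵘ_{z,a,ε}(η)` IS `C^n`** for `a ≠ 0` and a unit `u` (✓`contDiff_chartDeficit_of_letters`). [cite: Luscher1983, §2] -/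
theorem contDiff_trGnoDeficit {n : ℕ∞} {u : ℍ} (hu : ‖u‖ = 1) (z : Fin 3 → Bool) (χ : Site 3 L → SU2) {a : ℍ} (ha : a ≠ 0) (ε : GnoSign L) :
    ContDiff ℝ n (trGnoDeficit (L := L) u z χ a ε) :=
  contDiff_chartDeficit_of_letters (C := fun η : GnoCoord L => (blowUpPoint (L := L) 1 (trGnomonicPoint u a ε η)).1)
    (U := fun η : GnoCoord L => (blowUpPoint (L := L) 1 (trGnomonicPoint u a ε η)).2) z χ (contDiff_trLeader hu ha ε) (contDiff_trFollower u a ε)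

/-! ## §5 Joint smoothness in the hub-polar shift and the coordinates (twin of ✓`contDiff_gnoDeficit_hubShift`) -/

/-- ★ **Every leader of `blowUpPoint 1 (trGnomonicPoint u (a − c·1) ε η)` is `C^n` jointly in `(c, η)`** (`im a ≠ 0`, unit `u`). [folklore] -/
theorem contDiff_trLeader_hubShift {n : ℕ∞} {u : ℍ} (hu : ‖u‖ = 1) {a : ℍ} (ha : a.im ≠ 0) (ε : GnoSign L) (μ : Fin 4) :
    ContDiff ℝ n fun p : ℝ × GnoCoord L => su2Quat ((blowUpPoint (L := L) 1 (trGnomonicPoint u (a - p.1 • (1 : ℍ)) ε p.2)).1 μ) := by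
  by_cases hμ : μ = 2
  · subst hμ
    have e : (fun p : ℝ × GnoCoord L => su2Quat ((blowUpPoint (L := L) 1 (trGnomonicPoint u (a - p.1 • (1 : ℍ)) ε p.2)).1 2)) =
        fun p => u * su2Quat ((blowUpPoint (L := L) 1 (gnomonicPoint (a - p.1 • (1 : ℍ)) ε p.2)).1 2) :=
      funext fun p => su2Quat_trLeader_two hu _ ε p.2
    rw [e]
    exact contDiff_const.mul (contDiff_leader_hubShift ha ε 2)
  · have e : (fun p : ℝ × GnoCoord L => su2Quat ((blowUpPoint (L := L) 1 (trGnomonicPoint u (a - p.1 • (1 : ℍ)) ε p.2)).1 μ)) =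
        fun p => su2Quat ((blowUpPoint (L := L) 1 (gnomonicPoint (a - p.1 • (1 : ℍ)) ε p.2)).1 μ) :=
      funext fun p => by rw [trLeader_eq_of_ne_two u _ ε p.2 hμ]
    rw [e]
    exact contDiff_leader_hubShift ha ε μ

/-- Every follower of `blowUpPoint 1 (trGnomonicPoint u (a − c·1) ε η)` is `C^n` jointly in `(c, η)`. [folklore] -/
theorem contDiff_trFollower_hubShift {n : ℕ∞} (u a : ℍ) (ε : GnoSign L) (i : Fol L) :
    ContDiff ℝ n fun p : ℝ × GnoCoord L => su2Quat ((blowUpPoint (L := L) 1 (trGnomonicPoint u (a - p.1 • (1 : ℍ)) ε p.2)).2 i) := by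
  have e : (fun p : ℝ × GnoCoord L => su2Quat ((blowUpPoint (L := L) 1 (trGnomonicPoint u (a - p.1 • (1 : ℍ)) ε p.2)).2 i)) =
      fun p => su2Quat ((blowUpPoint (L := L) 1 (gnomonicPoint (a - p.1 • (1 : ℍ)) ε p.2)).2 i) := funext fun p => by rw [trFollower_eq]
  rw [e]
  exact contDiff_follower_hubShift a ε i

set_option maxHeartbeats 800000 in
/-- ★★ **THE TRANSLATED DEFICIT IS `C^n` JOINTLY IN THE HUB SHIFT AND THE COORDINATES** (`im a ≠ 0`, unit `u`):
`(c, η) ↦ trGnoDeficit u z χ (a − c·1) ε η` is `C^n` on `ℝ × GnoCoord L` — the regularity input of the sector-001 fibre (`δ = re a` is a fibre direction,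
LEAD g98 19:28Z). [cite: Luscher1983, §2] -/
theorem contDiff_trGnoDeficit_hubShift {n : ℕ∞} {u : ℍ} (hu : ‖u‖ = 1) (z : Fin 3 → Bool) (χ : Site 3 L → SU2) {a : ℍ} (ha : a.im ≠ 0) (ε : GnoSign L) :
    ContDiff ℝ n fun p : ℝ × GnoCoord L => trGnoDeficit u z χ (a - p.1 • (1 : ℍ)) ε p.2 :=
  contDiff_chartDeficit_of_letters (C := fun p : ℝ × GnoCoord L => (blowUpPoint (L := L) 1 (trGnomonicPoint u (a - p.1 • (1 : ℍ)) ε p.2)).1)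
    (U := fun p : ℝ × GnoCoord L => (blowUpPoint (L := L) 1 (trGnomonicPoint u (a - p.1 • (1 : ℍ)) ε p.2)).2) z χ (contDiff_trLeader_hubShift hu ha ε)
    (contDiff_trFollower_hubShift u a ε)

set_option maxHeartbeats 400000 in
/-- ★ **The joint ray** `s ↦ F̂ᵘ(a − (s·δ′)·1, ε, η₀ + s·ζ)` is `C^n` (`im a ≠ 0`, unit `u`). [folklore] -/
theorem contDiff_trGnoDeficit_hubShift_ray {n : ℕ∞} {u : ℍ} (hu : ‖u‖ = 1) (z : Fin 3 → Bool) (χ : Site 3 L → SU2) {a : ℍ} (ha : a.im ≠ 0)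
    (ε : GnoSign L) (δ : ℝ) (η₀ ζ : GnoCoord L) :
    ContDiff ℝ n fun s : ℝ => trGnoDeficit u z χ (a - (s * δ) • (1 : ℍ)) ε (η₀ + s • ζ) := by
  have hpath : ContDiff ℝ n fun s : ℝ => ((s * δ, η₀ + s • ζ) : ℝ × GnoCoord L) :=
    (contDiff_id.mul contDiff_const).prodMk (contDiff_const.add (contDiff_id.smul contDiff_const))
  have e : (fun s : ℝ => trGnoDeficit u z χ (a - (s * δ) • (1 : ℍ)) ε (η₀ + s • ζ)) =
      (fun p : ℝ × GnoCoord L => trGnoDeficit u z χ (a - p.1 • (1 : ℍ)) ε p.2) ∘ fun s : ℝ => ((s * δ, η₀ + s • ζ) : ℝ × GnoCoord L) := rfl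
  rw [e]
  exact (contDiff_trGnoDeficit_hubShift hu z χ ha ε).comp hpath

end Summit.QuantumFields.YangMills.Theorems.SwapVirialDeficit.Gnomonic

end
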